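import Mathlib
import HarnessLib
import Literature.Analysis.PDE.DivFormLiouville

/-!
# Route `PoloidalWindowDoor`, crux K2 (stmt-NavierStokesRegularity-19708) — task H5, step M4c (part 1): DESCENT of entire
# weak solutions of `div(a∇u) = 0` from `ℝⁿ` to `ℝⁿ⁺¹` (towards `divFormLiouville_holds` in dimensions `n ≤ 2`)

Seat ns-poloidal-K2-p3 g2 (`ledger fact claim` #1 on `Literature.Analysis.PDE.divFormLiouville`).  A solution `u` on `ℝⁿ`
lifts to `ũ(z) = u(πz)` on `ℝⁿ⁺¹` (`π` = forget the last coordinate), solving `div(ã∇ũ) = 0` with `ã = a ∘ π ⊕ 1`;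
hence Liouville in dimension `n+1` implies Liouville in dimension `n`, and the theorem for `n ≥ 3` (M4b) descends to all
`n`.  This file: the linear algebra of `π`, `ι` (re-embedding), the lifted coefficients and their ellipticity/bounds, the
`C¹` lift and its partial derivatives, and the slice test functions `η_t = η̃(ι · + t e_last)`.

* `proj`, `emb` — `π : ℝⁿ⁺¹ →L ℝⁿ`, `ι : ℝⁿ →L ℝⁿ⁺¹` and their coordinates; `emb_proj_add`: `ι(πz) + z_last e_last = z`;
* `liftCoeff` — `ã`, measurable, symmetric, `min(λ,1)|ξ|² ≤ ξ·ãξ`, `|ãᵢⱼ| ≤ max(Λ,1)`;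
* `fderiv_lift_single_castSucc` / `_last` — `∂_{i}ũ = (∂ᵢu)∘π`, `∂_{last}ũ = 0`;
* `sliceTest` — `η_t ∈ C¹_c(ℝⁿ)` and `∂ⱼη_t(πz) = ∂_{j}η̃(z)` at `t = z_last`;
* `lift_integrand_eq` — the lifted weak-form integrand at `z` equals the `n`-dimensional one for `η_{z_last}` at `πz`.

WHAT THIS IS NOT: the Fubini step and the final `divFormLiouville_holds` are in the sequel (M4c part 2); nothing NS-specific.
-/

noncomputable section

open MeasureTheory Set Function Filter Topology Metric Module
open scoped Matrix ENNReal NNReal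

-- the summit and its single sub-problem share the name (CONVENTIONS §1), as in every Theorems file
set_option linter.dupNamespace false

namespace Summit.NavierStokesRegularity.NavierStokesRegularity.Theorems.PoloidalWindowDoorPoloidalWindowRigidityDivFormDescent

variable {n : ℕ}

/-! ### Forgetting and restoring the last coordinate -/

/-- `π : ℝⁿ⁺¹ → ℝⁿ`, `(πz)ⱼ = z_{castSucc j}`. -/
def proj (n : ℕ) : EuclideanSpace ℝ (Fin (n + 1)) →L[ℝ] EuclideanSpace ℝ (Fin n) :=
  ∑ j : Fin n, (EuclideanSpace.proj (Fin.castSucc j)).smulRight (EuclideanSpace.single j (1 : ℝ))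

/-- `ι : ℝⁿ → ℝⁿ⁺¹`, `(ιx)_{castSucc j} = xⱼ`, `(ιx)_{last} = 0`. -/
def emb (n : ℕ) : EuclideanSpace ℝ (Fin n) →L[ℝ] EuclideanSpace ℝ (Fin (n + 1)) :=
  ∑ j : Fin n, (EuclideanSpace.proj j).smulRight (EuclideanSpace.single (Fin.castSucc j) (1 : ℝ))

/-- Coordinates of `π`. -/
@[simp] theorem proj_apply (z : EuclideanSpace ℝ (Fin (n + 1))) (j : Fin n) : proj n z j = z (Fin.castSucc j) := by
  simp [proj, WithLp.ofLp_sum, Finset.sum_apply, Pi.single_apply]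

/-- Coordinates of `ι` on `castSucc`. -/
@[simp] theorem emb_apply_castSucc (x : EuclideanSpace ℝ (Fin n)) (j : Fin n) :
    emb n x (Fin.castSucc j) = x j := by
  simp [emb, WithLp.ofLp_sum, Finset.sum_apply, Pi.single_apply]

/-- The last coordinate of `ι x` vanishes. -/
@[simp] theorem emb_apply_last (x : EuclideanSpace ℝ (Fin n)) : emb n x (Fin.last n) = 0 := by
  simp [emb, WithLp.ofLp_sum, Finset.sum_apply, (Fin.castSucc_lt_last _).ne']

/-- `π (ι x) = x`. -/
@[simp] theorem proj_emb (x : EuclideanSpace ℝ (Fin n)) : proj n (emb n x) = x :=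
  PiLp.ext fun j => by simp

/-- `π e_last = 0`. -/
@[simp] theorem proj_single_last : proj n (EuclideanSpace.single (Fin.last n) (1 : ℝ)) = 0 :=
  PiLp.ext fun j => by simp [(Fin.castSucc_lt_last j).ne]

/-- `π e_{castSucc i} = e_i`. -/
@[simp] theorem proj_single_castSucc (i : Fin n) :
    proj n (EuclideanSpace.single (Fin.castSucc i) (1 : ℝ)) = EuclideanSpace.single i 1 :=
  PiLp.ext fun j => by simp [PiLp.single_apply, Fin.castSucc_inj]

/-- `ι e_j = e_{castSucc j}`. -/
@[simp] theorem emb_single (j : Fin n) :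
    emb n (EuclideanSpace.single j (1 : ℝ)) = EuclideanSpace.single (Fin.castSucc j) 1 := by
  refine PiLp.ext fun I => ?_
  refine Fin.lastCases ?_ (fun i => ?_) I
  · simp [(Fin.castSucc_lt_last j).ne']
  · simp [PiLp.single_apply, Fin.castSucc_inj]

/-- `ι(πz) + z_last e_last = z`. -/
theorem emb_proj_add (z : EuclideanSpace ℝ (Fin (n + 1))) :
    emb n (proj n z) + z (Fin.last n) • EuclideanSpace.single (Fin.last n) (1 : ℝ) = z := by
  refine PiLp.ext fun I => ?_
  refine Fin.lastCases ?_ (fun i => ?_) I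
  · simp
  · simp [(Fin.castSucc_lt_last i).ne]

/-- The affine slice embedding at height `t`: `J_t x = ι x + t e_last`; `π (J_t x) = x`, `(J_t x)_last = t`. -/
theorem proj_slice (t : ℝ) (x : EuclideanSpace ℝ (Fin n)) :
    proj n (emb n x + t • EuclideanSpace.single (Fin.last n) (1 : ℝ)) = x := by
  rw [map_add, map_smul, proj_emb, proj_single_last, smul_zero, add_zero]

/-- `(J_t x)_last = t`. -/
theorem slice_last (t : ℝ) (x : EuclideanSpace ℝ (Fin n)) :
    (emb n x + t • EuclideanSpace.single (Fin.last n) (1 : ℝ)) (Fin.last n) = t := by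
  simp


/-- `ι` is injective (`π ∘ ι = id`). -/
theorem emb_injective : Function.Injective (emb n) := fun x y h => by
  have := congrArg (proj n) h
  simpa using this

/-! ### The lifted coefficients `ã = (a ∘ π) ⊕ 1` -/

/-- `ã(z)`: the block matrix `a(πz)` on the `castSucc` indices, `1` at `(last,last)`, `0` elsewhere. -/
def liftCoeff (a : EuclideanSpace ℝ (Fin n) → Matrix (Fin n) (Fin n) ℝ) (z : EuclideanSpace ℝ (Fin (n + 1))) :
    Matrix (Fin (n + 1)) (Fin (n + 1)) ℝ :=
  Matrix.of fun I J => Fin.lastCases (Fin.lastCases (1 : ℝ) (fun _ => 0) J)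
    (fun i => Fin.lastCases (0 : ℝ) (fun j => a (proj n z) i j) J) I

/-- The `castSucc`-block of `ã` is `a ∘ π`. -/
@[simp] theorem liftCoeff_castSucc_castSucc (a : EuclideanSpace ℝ (Fin n) → Matrix (Fin n) (Fin n) ℝ)
    (z : EuclideanSpace ℝ (Fin (n + 1))) (i j : Fin n) :
    liftCoeff a z (Fin.castSucc i) (Fin.castSucc j) = a (proj n z) i j := by
  simp [liftCoeff]

/-- The mixed entries of `ã` vanish. -/
@[simp] theorem liftCoeff_castSucc_last (a : EuclideanSpace ℝ (Fin n) → Matrix (Fin n) (Fin n) ℝ)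
    (z : EuclideanSpace ℝ (Fin (n + 1))) (i : Fin n) : liftCoeff a z (Fin.castSucc i) (Fin.last n) = 0 := by
  simp [liftCoeff]

/-- The mixed entries of `ã` vanish. -/
@[simp] theorem liftCoeff_last_castSucc (a : EuclideanSpace ℝ (Fin n) → Matrix (Fin n) (Fin n) ℝ)
    (z : EuclideanSpace ℝ (Fin (n + 1))) (j : Fin n) : liftCoeff a z (Fin.last n) (Fin.castSucc j) = 0 := by
  simp [liftCoeff]

/-- The corner entry of `ã` is `1`. -/
@[simp] theorem liftCoeff_last_last (a : EuclideanSpace ℝ (Fin n) → Matrix (Fin n) (Fin n) ℝ)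
    (z : EuclideanSpace ℝ (Fin (n + 1))) : liftCoeff a z (Fin.last n) (Fin.last n) = 1 := by
  simp [liftCoeff]

variable {a : EuclideanSpace ℝ (Fin n) → Matrix (Fin n) (Fin n) ℝ} {lam Λ : ℝ}

/-- `ã` has measurable entries. -/
theorem measurable_liftCoeff (hmeas : ∀ i j, Measurable fun y => a y i j) (I J : Fin (n + 1)) :
    Measurable fun z => liftCoeff a z I J := by
  refine Fin.lastCases ?_ (fun i => ?_) I <;> refine Fin.lastCases ?_ (fun j => ?_) J
  · simp only [liftCoeff_last_last]; exact measurable_const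
  · simp only [liftCoeff_last_castSucc]; exact measurable_const
  · simp only [liftCoeff_castSucc_last]; exact measurable_const
  · simp only [liftCoeff_castSucc_castSucc]; exact (hmeas i j).comp (proj n).continuous.measurable

/-- `ã` is symmetric. -/
theorem isSymm_liftCoeff (hsymm : ∀ y, (a y).IsSymm) (z : EuclideanSpace ℝ (Fin (n + 1))) :
    (liftCoeff a z).IsSymm := by
  refine Matrix.IsSymm.ext fun I J => ?_
  refine Fin.lastCases ?_ (fun i => ?_) I <;> refine Fin.lastCases ?_ (fun j => ?_) J
  · simp
  · simp
  · simp
  · simp only [liftCoeff_castSucc_castSucc]; exact (hsymm _).apply i j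

/-- `ã` is uniformly elliptic with constant `min λ 1`. -/
theorem liftCoeff_elliptic (hell : ∀ y (ξ : Fin n → ℝ), lam * (ξ ⬝ᵥ ξ) ≤ ξ ⬝ᵥ (a y *ᵥ ξ))
    (z : EuclideanSpace ℝ (Fin (n + 1))) (ξ : Fin (n + 1) → ℝ) :
    min lam 1 * (ξ ⬝ᵥ ξ) ≤ ξ ⬝ᵥ (liftCoeff a z *ᵥ ξ) := by
  have h := hell (proj n z) (fun i => ξ (Fin.castSucc i))
  simp only [dotProduct, Matrix.mulVec] at h ⊢
  simp only [Fin.sum_univ_castSucc, liftCoeff_castSucc_castSucc, liftCoeff_castSucc_last, liftCoeff_last_castSucc,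
    liftCoeff_last_last, zero_mul, add_zero, Finset.sum_const_zero, zero_add, one_mul]
  have hS : 0 ≤ ∑ i : Fin n, ξ (Fin.castSucc i) * ξ (Fin.castSucc i) :=
    Finset.sum_nonneg fun i _ => mul_self_nonneg _
  have ht : 0 ≤ ξ (Fin.last n) * ξ (Fin.last n) := mul_self_nonneg _
  have hm1 : min lam 1 ≤ lam := min_le_left _ _
  have hm2 : min lam 1 ≤ 1 := min_le_right _ _
  nlinarith

/-- `|ãᵢⱼ| ≤ max Λ 1`. -/
theorem abs_liftCoeff_le (hbd : ∀ y i j, |a y i j| ≤ Λ) (z : EuclideanSpace ℝ (Fin (n + 1))) (I J : Fin (n + 1)) :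
    |liftCoeff a z I J| ≤ max Λ 1 := by
  refine Fin.lastCases ?_ (fun i => ?_) I <;> refine Fin.lastCases ?_ (fun j => ?_) J
  · simp
  · simp
  · simp
  · simp only [liftCoeff_castSucc_castSucc]; exact (hbd _ i j).trans (le_max_left _ _)

/-! ### The lifted solution `ũ = u ∘ π` and the slice test functions -/

variable {u : EuclideanSpace ℝ (Fin n) → ℝ}

/-- `ũ ∈ C¹`. -/
theorem contDiff_lift (hu : ContDiff ℝ 1 u) : ContDiff ℝ 1 fun z => u (proj n z) := hu.comp (proj n).contDiff

/-- Partial derivatives of `ũ`: `∂_I ũ(z) = Du(πz)[π e_I]`. -/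
theorem fderiv_lift (hu : ContDiff ℝ 1 u) (z : EuclideanSpace ℝ (Fin (n + 1))) (v : EuclideanSpace ℝ (Fin (n + 1))) :
    fderiv ℝ (fun z => u (proj n z)) z v = fderiv ℝ u (proj n z) (proj n v) := by
  have h := (((hu.differentiable one_ne_zero) (proj n z)).hasFDerivAt).comp z (proj n).hasFDerivAt
  rw [show (fun z => u (proj n z)) = u ∘ proj n from rfl, h.fderiv]
  rfl

/-- The slice test function `η_t(x) = η̃(ιx + t e_last)` is `C¹`… -/
theorem contDiff_slice {η : EuclideanSpace ℝ (Fin (n + 1)) → ℝ} (hη : ContDiff ℝ 1 η) (t : ℝ) :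
    ContDiff ℝ 1 fun x => η (emb n x + t • EuclideanSpace.single (Fin.last n) (1 : ℝ)) :=
  hη.comp ((emb n).contDiff.add contDiff_const)

/-- … and compactly supported. -/
theorem hasCompactSupport_slice {η : EuclideanSpace ℝ (Fin (n + 1)) → ℝ} (hηc : HasCompactSupport η) (t : ℝ) :
    HasCompactSupport fun x => η (emb n x + t • EuclideanSpace.single (Fin.last n) (1 : ℝ)) := by
  have hemb : IsClosedEmbedding (emb n) := by
    have hker : LinearMap.ker ((emb n : EuclideanSpace ℝ (Fin n) →L[ℝ] EuclideanSpace ℝ (Fin (n + 1))) :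
        EuclideanSpace ℝ (Fin n) →ₗ[ℝ] EuclideanSpace ℝ (Fin (n + 1))) = ⊥ :=
      LinearMap.ker_eq_bot.2 (emb_injective (n := n))
    exact LinearMap.isClosedEmbedding_of_injective hker
  have hg : IsClosedEmbedding fun x => emb n x + t • EuclideanSpace.single (Fin.last n) (1 : ℝ) :=
    (Homeomorph.addRight (t • EuclideanSpace.single (Fin.last n) (1 : ℝ))).isClosedEmbedding.comp hemb
  exact hηc.comp_isClosedEmbedding hg

/-- Partial derivatives of the slice: `∂ⱼη_t(x) = ∂_{castSucc j} η̃(ιx + t e_last)`. -/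
theorem fderiv_slice {η : EuclideanSpace ℝ (Fin (n + 1)) → ℝ} (hη : ContDiff ℝ 1 η) (t : ℝ)
    (x : EuclideanSpace ℝ (Fin n)) (j : Fin n) :
    fderiv ℝ (fun x => η (emb n x + t • EuclideanSpace.single (Fin.last n) (1 : ℝ))) x (EuclideanSpace.single j 1) =
      fderiv ℝ η (emb n x + t • EuclideanSpace.single (Fin.last n) (1 : ℝ)) (EuclideanSpace.single (Fin.castSucc j) 1) := by
  have hg : HasFDerivAt (fun x => emb n x + t • EuclideanSpace.single (Fin.last n) (1 : ℝ)) (emb n) x :=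
    (emb n).hasFDerivAt.add_const _
  have h := (((hη.differentiable one_ne_zero) _).hasFDerivAt).comp x hg
  rw [show (fun x => η (emb n x + t • EuclideanSpace.single (Fin.last n) (1 : ℝ))) =
    η ∘ fun x => emb n x + t • EuclideanSpace.single (Fin.last n) (1 : ℝ) from rfl, h.fderiv]
  simp

/-- **The lifted weak-form integrand equals the `n`-dimensional one on the slice through `z`.** -/
theorem lift_integrand_eq (hu : ContDiff ℝ 1 u) {η : EuclideanSpace ℝ (Fin (n + 1)) → ℝ} (hη : ContDiff ℝ 1 η)
    (z : EuclideanSpace ℝ (Fin (n + 1))) :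
    ∑ I, ∑ J, liftCoeff a z I J * fderiv ℝ (fun z => u (proj n z)) z (EuclideanSpace.single I 1) *
        fderiv ℝ η z (EuclideanSpace.single J 1) =
      ∑ i, ∑ j, a (proj n z) i j * fderiv ℝ u (proj n z) (EuclideanSpace.single i 1) *
        fderiv ℝ (fun x => η (emb n x + z (Fin.last n) • EuclideanSpace.single (Fin.last n) (1 : ℝ))) (proj n z)
          (EuclideanSpace.single j 1) := by
  simp only [fderiv_lift hu, fderiv_slice hη, emb_proj_add, Fin.sum_univ_castSucc, proj_single_castSucc,
    proj_single_last, map_zero, liftCoeff_castSucc_castSucc, liftCoeff_castSucc_last, liftCoeff_last_castSucc,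
    liftCoeff_last_last, zero_mul, mul_zero, add_zero, Finset.sum_const_zero]

end Summit.NavierStokesRegularity.NavierStokesRegularity.Theorems.PoloidalWindowDoorPoloidalWindowRigidityDivFormDescent

end
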